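import Summits.KontsevichZagierPeriods.Zeta5Search.BrickZudilinPartner
import Summits.KontsevichZagierPeriods.Zeta5Search.SymmetricFamilyMarginQ
import Summits.KontsevichZagierPeriods.Zeta5Search.SymmetricFamilyCertificates
import Literature.NumberTheory.Irrationality.Zudilin2002.ZetaFiveRecursion
import HarnessLib

/-!
# Zudilin 2002's integrality `4D_n²qₙ, 4D_n⁷pₙ, 4D_n⁵p̃ₙ ∈ ℤ` IS its 2-adic residual (cell `pub-zeta5`, seat ct-1 g39)

HONEST FRAMING: systematic search; no irrationality claim unless certified.  Bookkeeping of `p`-adic valuations of the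
three solutions `qₙ, pₙ, p̃ₙ` of Zudilin's third-order recursion for `ζ(5)` (Mat. Zametki **72** (2002) 796–800, (1));
nothing here concerns the arithmetic nature of `ζ(5)`; NOTHING IS DISCHARGED — the named Literature fact
`Zudilin2002.integrality` stays a named fact (net debt 0); records in print UNMOVED.

OUR work (Summit side).  The tree already proves

* at every ODD prime `p`: `D_n²qₙ, D_n⁷pₙ, D_n⁵p̃ₙ ∈ ℤ_(p)` (cell zeta5-irr, `BrickZudilinPartner.integrality_odd_prime`, from
  Zudilin's (15) `SymRay.eq15` and the six inclusions (14) at odd `p`), and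
* the gauge `qₙ = (−1)^{n+1} C(2n,n) Qₙ` with Brown–Zudilin's natural number `Qₙ` (`SymmetricRecursion.zudilin_q_eq`).

This file records what is therefore LEFT of the named fact, as kernel statements:

* `q_isInt`, `integrality_q` — `qₙ ∈ ℤ`, hence the first conjunct `4D_n²qₙ ∈ ℤ`, for EVERY `n` (unconditional);
* `integrality_iff_two_adic` — **`Zudilin2002.integrality ↔ ∀ n ≥ 1, ord₂(D_n⁷pₙ) ≥ −2 ∧ ord₂(D_n⁵p̃ₙ) ≥ −2`**
  (valuations as `Rat.padicValuation 2 (·) ≤ exp 2`): the named fact is EXACTLY its `2`-adic content, i.e. the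
  Krattenthaler–Rivoal `d_n`-saving at the prime `2` for the kernel `(6,1,1)` and its partner;
* `two_adic_of_coeffs` — the printed route to that content: the `2`-parts of the six inclusions (14)
  (`2uₙ, 2D_n²wₙ, 2D_n⁵vₙ ∈ ℤ₂` and the partner ones) imply the right-hand side, through (15);
* `integrality_upto_fifty`, `two_adic_upto_fifty` — for `1 ≤ n ≤ 50` all three inclusions (hence the `2`-adic residual)
  hold, from the cell's kernel certificate of Zudilin's display (6) (`SymmetricFamily.zudilin_display6`: `qₙ ∈ ℤ`,
  `2D_n⁵pₙ ∈ ℤ`, `2D_n³p̃ₙ ∈ ℤ`), so the residual concerns `n > 50` only.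

DATA (seat desk, exact, `n ≤ 20`; not used by the kernel): `ord₂(uₙ) = ord₂(D_n²wₙ) = ord₂(D_n⁵vₙ) = 0` exactly,
`ord₂(ũₙ) = 2·ord₂(n) + ord₂(n′+1)` (`n′` the odd part of `n`), `ord₂(D_n²w̃ₙ)` the same except one more at
`n = 1, 2, 4, 8, 16`, `ord₂(D_n⁵ṽₙ) ≥ −1` with equality only at `n = 1`; the TERMWISE bounds on the partial-fraction cells do not give the right-hand side — the worst cell of `uₙ` is
short by one power of `2` at `n = 5, 10, 11, 13, 20` and by two at `n = 9, 19` (a genuine cancellation in the sum over the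
poles, as at odd primes).
-/

noncomputable section

open WithZero

namespace Summit.KontsevichZagierPeriods.Zeta5Search.Zudilin2002IntegralityTwoAdic

open Literature.NumberTheory.Irrationality
open Literature.NumberTheory.Irrationality.Zudilin2002 (q p ptilde uC wC vC utC wtC vtC minorP minorPt integrality)
open Summit.KontsevichZagierPeriods.Zeta5Search.BrickZudilinPartner (integrality_odd_prime)
open Summit.KontsevichZagierPeriods.Zeta5Search.BrickDenominators (le_exp_of_pow_mul_le)
open Summit.KontsevichZagierPeriods.Zeta5Search.SymmetricRecursion (zudilin_q_eq)
open Summit.KontsevichZagierPeriods.Zeta5Search.SymmetricFamily (zudilin_display6)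

/-! ### Generic valuation bookkeeping -/

/-- An integer has `p`-adic valuation `≤ 1`. [folklore] -/
theorem padicValuation_intCast_le_one (p : ℕ) [Fact p.Prime] (z : ℤ) :
    Rat.padicValuation p (z : ℚ) ≤ 1 := by
  rw [Rat.padicValuation_le_one_iff, Rat.den_intCast]
  exact (Fact.out : p.Prime).not_dvd_one

/-- A rational number with `p`-adic valuation `≤ 1` at EVERY prime `p` is an integer. [folklore] -/
theorem exists_int_of_forall_padicValuation_le_one {x : ℚ}
    (h : ∀ (p : ℕ) (hp : p.Prime), @Rat.padicValuation p ⟨hp⟩ x ≤ 1) : ∃ z : ℤ, x = z := by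
  have hden : x.den = 1 := by
    by_contra h1
    obtain ⟨p, hp, hdvd⟩ := Nat.exists_prime_and_dvd h1
    have h' := h p hp
    rw [@Rat.padicValuation_le_one_iff p ⟨hp⟩] at h'
    exact h' hdvd
  exact ⟨x.num, ((Rat.den_eq_one_iff x).mp hden).symm⟩

/-- `v₂(4) = exp(−2)`. [folklore] -/
theorem padicValuation_two_four : Rat.padicValuation 2 (4 : ℚ) = exp (-2) := by
  rw [show (4 : ℚ) = ((2 : ℕ) : ℚ) ^ 2 by norm_num, map_pow, Rat.padicValuation_self, ← exp_nsmul]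
  norm_num

/-- From `p`-integrality at every odd prime and `ord₂ ≥ −2` to `4x ∈ ℤ`. [folklore] -/
theorem exists_int_four_mul {x : ℚ}
    (hodd : ∀ (p : ℕ) (hp : p.Prime), p ≠ 2 → @Rat.padicValuation p ⟨hp⟩ x ≤ 1)
    (h2 : Rat.padicValuation 2 x ≤ exp 2) : ∃ z : ℤ, 4 * x = z := by
  refine exists_int_of_forall_padicValuation_le_one fun r hr => ?_
  haveI : Fact r.Prime := ⟨hr⟩
  rw [map_mul]
  by_cases hr2 : r = 2
  · subst hr2
    rw [padicValuation_two_four]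
    calc exp (-2) * Rat.padicValuation 2 x ≤ exp (-2) * exp 2 :=
        mul_le_mul' le_rfl h2
      _ = 1 := by rw [← exp_add, ← exp_zero]; norm_num
  · have h4 : Rat.padicValuation r (4 : ℚ) ≤ 1 := by exact_mod_cast padicValuation_intCast_le_one r 4
    exact mul_le_one' h4 (hodd r hr hr2)

/-- Conversely, `4x ∈ ℤ` forces `ord₂(x) ≥ −2`. [folklore] -/
theorem padicValuation_two_le_of_four_mul {x : ℚ} (h : ∃ z : ℤ, 4 * x = z) :
    Rat.padicValuation 2 x ≤ exp 2 := by
  obtain ⟨z, hz⟩ := h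
  have h' : Rat.padicValuation 2 (((2 : ℕ) : ℚ) ^ 2 * x) ≤ exp (-(0 : ℤ)) := by
    rw [show ((2 : ℕ) : ℚ) ^ 2 * x = 4 * x by norm_num, hz, neg_zero, exp_zero]
    exact padicValuation_intCast_le_one 2 z
  simpa using le_exp_of_pow_mul_le (p := 2) h'

/-! ### The `q`-conjunct, unconditionally -/

/-- **`qₙ ∈ ℤ` for every `n`** — through the proved gauge `qₙ = (−1)^{n+1}C(2n,n)Qₙ` with Brown–Zudilin's binomial sum
`Qₙ ∈ ℕ` (eq. (7) of arXiv:2210.03391); this is the first inclusion of Zudilin's display (6), in print «by straightforward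
calculations on the basis of the recursion (1)». [cite: Zudilin2002Zeta5, Sect. 1, display (6)] -/
theorem q_isInt (n : ℕ) : ∃ z : ℤ, q n = z :=
  ⟨(-1) ^ (n + 1) * (Nat.centralBinom n : ℤ) * (BrownZudilin2022.Q n : ℤ), by rw [zudilin_q_eq]; push_cast; ring⟩

/-- **The first conjunct of `Zudilin2002.integrality`, for every `n`**: `4D_n²qₙ ∈ ℤ` (`D_n = lcm(1,…,n)`).
[cite: Zudilin2002Zeta5, Sect. 1 (display before (6))] -/
theorem integrality_q (n : ℕ) : ∃ z : ℤ, 4 * (Nat.lcmUpto n : ℚ) ^ 2 * q n = z := by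
  obtain ⟨z, hz⟩ := q_isInt n
  exact ⟨4 * (Nat.lcmUpto n : ℤ) ^ 2 * z, by rw [hz]; push_cast; ring⟩

/-! ### The named fact is its `2`-adic residual -/

/-- **`Zudilin2002.integrality` ⟺ its `2`-adic content.**  With `D_n = lcm(1,…,n)`:
`(∀ n ≥ 1, 4D_n²qₙ ∈ ℤ ∧ 4D_n⁷pₙ ∈ ℤ ∧ 4D_n⁵p̃ₙ ∈ ℤ) ↔ (∀ n ≥ 1, ord₂(D_n⁷pₙ) ≥ −2 ∧ ord₂(D_n⁵p̃ₙ) ≥ −2)`.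
`←`: the odd primes are the tree's `BrickZudilinPartner.integrality_odd_prime` (cell zeta5-irr), the `q`-conjunct is
`integrality_q`; `→`: an integer has non-negative `2`-adic order.  What remains of the named fact is thus exactly the
Krattenthaler–Rivoal saving of one `d_n` at the prime `2` (Mem. AMS 186 (2007) no. 875, Théorème 1; Zudilin derives it
from Vasilyev's integrals). [cite: Zudilin2002Zeta5, Sect. 1 (display before (6)) and Sect. 2 (14)–(15)] -/
theorem integrality_iff_two_adic :
    integrality ↔
      ∀ n : ℕ, 1 ≤ n →
        Rat.padicValuation 2 ((Nat.lcmUpto n : ℚ) ^ 7 * p n) ≤ exp 2 ∧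
          Rat.padicValuation 2 ((Nat.lcmUpto n : ℚ) ^ 5 * ptilde n) ≤ exp 2 := by
  constructor
  · intro h n hn
    obtain ⟨-, ⟨z₁, hz₁⟩, ⟨z₂, hz₂⟩⟩ := h n hn
    exact ⟨padicValuation_two_le_of_four_mul ⟨z₁, by rw [← hz₁]; ring⟩,
      padicValuation_two_le_of_four_mul ⟨z₂, by rw [← hz₂]; ring⟩⟩
  · intro h n hn
    obtain ⟨h7, h5⟩ := h n hn
    refine ⟨integrality_q n, ?_, ?_⟩
    · obtain ⟨z, hz⟩ := exists_int_four_mul (fun r hr hr2 => (@integrality_odd_prime r ⟨hr⟩ hr2 n).2.1) h7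
      exact ⟨z, by rw [← hz]; ring⟩
    · obtain ⟨z, hz⟩ := exists_int_four_mul (fun r hr hr2 => (@integrality_odd_prime r ⟨hr⟩ hr2 n).2.2) h5
      exact ⟨z, by rw [← hz]; ring⟩

/-- **The printed route to the residual: the `2`-parts of the six inclusions (14).**  If at the prime `2`
`ord₂(uₙ), ord₂(D_n²wₙ), ord₂(D_n⁵vₙ), ord₂(ũₙ), ord₂(D_n²w̃ₙ), ord₂(D_n⁵ṽₙ) ≥ −1` (Zudilin's (14): `2uₙ, 2D_n²wₙ, 2D_n⁵vₙ ∈ ℤ`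
and the partner inclusions, read at `2`), then `ord₂(D_n⁷pₙ), ord₂(D_n⁵p̃ₙ) ≥ −2` — by (15) `pₙ = w̃ₙvₙ − wₙṽₙ`,
`p̃ₙ = uₙṽₙ − ũₙvₙ` (`SymRay.eq15`, proved in the tree). [cite: Zudilin2002Zeta5, Sect. 2 (14)–(15)] -/
theorem two_adic_of_coeffs (n : ℕ)
    (hu : Rat.padicValuation 2 (uC n) ≤ exp 1)
    (hw : Rat.padicValuation 2 ((Nat.lcmUpto n : ℚ) ^ 2 * wC n) ≤ exp 1)
    (hv : Rat.padicValuation 2 ((Nat.lcmUpto n : ℚ) ^ 5 * vC n) ≤ exp 1)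
    (hut : Rat.padicValuation 2 (utC n) ≤ exp 1)
    (hwt : Rat.padicValuation 2 ((Nat.lcmUpto n : ℚ) ^ 2 * wtC n) ≤ exp 1)
    (hvt : Rat.padicValuation 2 ((Nat.lcmUpto n : ℚ) ^ 5 * vtC n) ≤ exp 1) :
    Rat.padicValuation 2 ((Nat.lcmUpto n : ℚ) ^ 7 * p n) ≤ exp 2 ∧
      Rat.padicValuation 2 ((Nat.lcmUpto n : ℚ) ^ 5 * ptilde n) ≤ exp 2 := by
  obtain ⟨-, hpp, hpt⟩ := SymRay.eq15 n
  have h11 : exp (1 : ℤ) * exp 1 = exp 2 := by rw [← exp_add]; norm_num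
  set d : ℚ := (Nat.lcmUpto n : ℚ) with hd
  constructor
  · rw [hpp, minorP, show d ^ 7 * (wtC n * vC n - wC n * vtC n) =
        (d ^ 2 * wtC n) * (d ^ 5 * vC n) - (d ^ 2 * wC n) * (d ^ 5 * vtC n) by ring]
    refine (Valuation.map_sub _ _ _).trans (max_le ?_ ?_)
    · rw [map_mul, ← h11]; exact mul_le_mul' hwt hv
    · rw [map_mul, ← h11]; exact mul_le_mul' hw hvt
  · rw [hpt, minorPt, show d ^ 5 * (uC n * vtC n - utC n * vC n) =
        uC n * (d ^ 5 * vtC n) - utC n * (d ^ 5 * vC n) by ring]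
    refine (Valuation.map_sub _ _ _).trans (max_le ?_ ?_)
    · rw [map_mul, ← h11]; exact mul_le_mul' hu hvt
    · rw [map_mul, ← h11]; exact mul_le_mul' hut hv

/-- **Consequently**: the `2`-parts of (14), for all `n ≥ 1`, would discharge the named fact outright.
[cite: Zudilin2002Zeta5, Sect. 2 (14)–(15)] -/
theorem integrality_of_coeffs
    (h : ∀ n : ℕ, 1 ≤ n →
      Rat.padicValuation 2 (uC n) ≤ exp 1 ∧
      Rat.padicValuation 2 ((Nat.lcmUpto n : ℚ) ^ 2 * wC n) ≤ exp 1 ∧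
      Rat.padicValuation 2 ((Nat.lcmUpto n : ℚ) ^ 5 * vC n) ≤ exp 1 ∧
      Rat.padicValuation 2 (utC n) ≤ exp 1 ∧
      Rat.padicValuation 2 ((Nat.lcmUpto n : ℚ) ^ 2 * wtC n) ≤ exp 1 ∧
      Rat.padicValuation 2 ((Nat.lcmUpto n : ℚ) ^ 5 * vtC n) ≤ exp 1) :
    integrality :=
  integrality_iff_two_adic.mpr fun n hn => by
    obtain ⟨hu, hw, hv, hut, hwt, hvt⟩ := h n hn
    exact two_adic_of_coeffs n hu hw hv hut hwt hvt

/-! ### The first fifty indices, unconditionally -/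

/-- **`Zudilin2002.integrality` holds for `1 ≤ n ≤ 50`** (all three inclusions), from the cell's kernel certificate of
Zudilin's SHARPER display (6) — `qₙ ∈ ℤ`, `2D_n⁵pₙ ∈ ℤ`, `2D_n³p̃ₙ ∈ ℤ` for `1 ≤ n ≤ 50` (`SymmetricFamily.zudilin_display6`,
exact rational arithmetic by `decide +kernel`): `4D_n⁷pₙ = 2D_n²·(2D_n⁵pₙ)`, `4D_n⁵p̃ₙ = 2D_n²·(2D_n³p̃ₙ)`.
[cite: Zudilin2002Zeta5, Sect. 1, display (6) and the display before it] -/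
theorem integrality_upto_fifty {n : ℕ} (h1 : 1 ≤ n) (h50 : n ≤ 50) :
    (∃ z : ℤ, 4 * (Nat.lcmUpto n : ℚ) ^ 2 * q n = z) ∧
      (∃ z : ℤ, 4 * (Nat.lcmUpto n : ℚ) ^ 7 * p n = z) ∧
        (∃ z : ℤ, 4 * (Nat.lcmUpto n : ℚ) ^ 5 * ptilde n = z) := by
  obtain ⟨-, ⟨z₁, hz₁⟩, ⟨z₂, hz₂⟩⟩ := zudilin_display6 h1 h50
  refine ⟨integrality_q n, ⟨2 * (Nat.lcmUpto n : ℤ) ^ 2 * z₁, ?_⟩, ⟨2 * (Nat.lcmUpto n : ℤ) ^ 2 * z₂, ?_⟩⟩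
  · push_cast; rw [hz₁]; ring
  · push_cast; rw [hz₂]; ring

/-- Hence the `2`-adic residual of `integrality_iff_two_adic` holds for `1 ≤ n ≤ 50`: `ord₂(D_n⁷pₙ) ≥ −2`,
`ord₂(D_n⁵p̃ₙ) ≥ −2`. [cite: Zudilin2002Zeta5, Sect. 1, display (6)] -/
theorem two_adic_upto_fifty {n : ℕ} (h1 : 1 ≤ n) (h50 : n ≤ 50) :
    Rat.padicValuation 2 ((Nat.lcmUpto n : ℚ) ^ 7 * p n) ≤ exp 2 ∧
      Rat.padicValuation 2 ((Nat.lcmUpto n : ℚ) ^ 5 * ptilde n) ≤ exp 2 := by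
  obtain ⟨-, ⟨z₁, hz₁⟩, ⟨z₂, hz₂⟩⟩ := integrality_upto_fifty h1 h50
  exact ⟨padicValuation_two_le_of_four_mul ⟨z₁, by rw [← hz₁]; ring⟩,
    padicValuation_two_le_of_four_mul ⟨z₂, by rw [← hz₂]; ring⟩⟩

end Summit.KontsevichZagierPeriods.Zeta5Search.Zudilin2002IntegralityTwoAdic
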